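import Summits.AnomalousDissipation.AnomalousDissipation.Theses.TwoAndHalfD
import Literature.Analysis.FluidPDE.PassiveScalarClassicalEnergy
import Literature.Analysis.FluidPDE.PassiveScalarForced
import Summits.AnomalousDissipation.AnomalousDissipation.Theorems.TwoAndHalfDScalarAnomalySteadySourceFormalColdStartVarianceToolkit

/-!
# D1 `stub_duhamelVariance`: the variance bound from the release envelope

Stub D1 of the line `Sketch` (duhamel-release) for the crux
`Summit.AnomalousDissipation.AnomalousDissipation.Theses.TwoAndHalfD.TwohalfdThesis`
(stmt-AnomalousDissipation-0206); the statement is registered verbatim in the line's checked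
skeleton and is consumed by the kernel-checked composition there.

CONTENT. Let `κ ≥ 0`, let `θ` be a classical solution of the sourced advection–diffusion equation
`∂ₜθ + u·∇θ = κΔθ + h` on `[0, ∞) × T²`, and for every release time `s ≥ 0` let `φ s` be a
classical solution of the UNFORCED equation on `[s, ∞)` with `φ s s = h`. Assume the weak Duhamel
identity `∫ θ(t) χ = ∫₀ᵗ (∫ φ s (t) χ) ds` for smooth `χ` (stub D0), and the release envelope
`‖φ s (t)‖²_{L²} ≤ Λ(t - s)² ‖h‖²_{L²}` for release times `s ≥ s₀`, where `Λ ≥ 0` is integrable on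
`[0, ∞)` with `∫ Λ ≤ M`. Then `‖θ(t)‖²_{L²} ≤ (s₀ + M)² ‖h‖²_{L²}` for every `t ≥ 0`.

PROOF (Minkowski under the Duhamel integral). Test the identity with `χ := θ(t)`:
`‖θ(t)‖² = ∫₀ᵗ F`, `F s := ∫ φ s (t) θ(t)`. By Cauchy–Schwarz `|F s| ≤ ‖φ s (t)‖ ‖θ(t)‖`; for
`0 ≤ s ≤ t` the `L²` norm of the unforced release does not increase
(`IsClassicalScalarTransportOn.antitoneOn_scalarL2Sq`), so `‖φ s (t)‖ ≤ ‖h‖`, while for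
`s₀ ≤ s ≤ t` the envelope gives `‖φ s (t)‖ ≤ Λ(t - s)‖h‖`. Splitting `[0, t]` at `min s₀ t`,
`‖θ(t)‖² ≤ (s₀ + ∫₀ᵗ Λ(t - s) ds) ‖h‖ ‖θ(t)‖ ≤ (s₀ + M) ‖h‖ ‖θ(t)‖`, and `B² ≤ K B ⇒ B² ≤ K²`.
(If `F` is not integrable the interval integral is `0` by convention and the bound is trivial.)
Supports stmt-AnomalousDissipation-0206. [folklore: Duhamel's principle, Evans 2010, §2.3.1 (c);
Minkowski's integral inequality]
-/

noncomputable section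

-- the summit path `AnomalousDissipation/AnomalousDissipation` duplicates a namespace component
set_option linter.dupNamespace false

namespace Summit.AnomalousDissipation.AnomalousDissipation.Theorems.TwohalfdThesis

open MeasureTheory Set Filter Topology
open scoped ENNReal NNReal InnerProductSpace
open Literature.Analysis.FunctionSpaces Literature.Analysis.FluidPDE

/-! ## Real-variable lemmas -/

/-- `B² ≤ K B` implies `B² ≤ K²` (no sign conditions: `K² - B² = (K - B)² + 2 (K B - B²)`).
[folklore] -/
theorem sq_le_sq_of_sq_le_mul {B K : ℝ} (h : B ^ 2 ≤ K * B) : B ^ 2 ≤ K ^ 2 := by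
  nlinarith [sq_nonneg (B - K)]

/-- Interval integrability of the reflected envelope `s ↦ Λ (t - s)` on `[m, t]`, `0 ≤ m ≤ t`,
for `Λ` integrable on `[0, ∞)`. [folklore] -/
theorem intervalIntegrable_comp_sub_left_of_integrableOn {Λ : ℝ → ℝ} {m t : ℝ}
    (hΛi : IntegrableOn Λ (Ici 0)) (hmt : m ≤ t) :
    IntervalIntegrable (fun s => Λ (t - s)) volume m t := by
  have h1 : IntervalIntegrable Λ volume 0 (t - m) := by
    refine MeasureTheory.IntegrableOn.intervalIntegrable (hΛi.mono_set ?_)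
    rw [uIcc_of_le (sub_nonneg.2 hmt)]
    exact Icc_subset_Ici_self
  have h2 := h1.comp_sub_left t
  rw [sub_zero, sub_sub_cancel] at h2
  exact h2.symm

/-- `∫ₘᵗ Λ (t - s) ds = ∫₀^{t - m} Λ ≤ ∫_{[0, ∞)} Λ ≤ M` for `Λ ≥ 0` integrable on `[0, ∞)` and
`m ≤ t`. [folklore] -/
theorem integral_comp_sub_left_le {Λ : ℝ → ℝ} {M m t : ℝ} (hΛ : ∀ τ, 0 ≤ Λ τ)
    (hΛi : IntegrableOn Λ (Ici 0)) (hM : ∫ τ in Ici 0, Λ τ ≤ M) (hmt : m ≤ t) :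
    ∫ s in m..t, Λ (t - s) ≤ M := by
  rw [intervalIntegral.integral_comp_sub_left Λ t, sub_self,
    intervalIntegral.integral_of_le (sub_nonneg.2 hmt)]
  refine le_trans (setIntegral_mono_set hΛi (ae_of_all _ fun τ => hΛ τ) ?_) hM
  exact ae_of_all _ fun τ hτ => (le_of_lt hτ.1 : τ ∈ Ici (0 : ℝ))

/-- **Splitting estimate under the Duhamel integral.** If `|F s| ≤ A B` for `0 < s ≤ t` and
`|F s| ≤ Λ (t - s) A B` for `s₀ < s ≤ t` (`A, B, s₀ ≥ 0`, `Λ ≥ 0` integrable on `[0, ∞)` with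
`∫ Λ ≤ M`), then `∫₀ᵗ F ≤ (s₀ + M) A B`: split `[0, t]` at `min s₀ t`, bound the first piece by
the constant and the second by the envelope, `∫_{min s₀ t}^t Λ (t - s) ds ≤ M`. (A non-integrable
`F` has interval integral `0`.) [folklore] -/
theorem integral_le_of_release_envelope {F Λ : ℝ → ℝ} {A B s₀ M t : ℝ} (hA : 0 ≤ A) (hB : 0 ≤ B)
    (hs₀ : 0 ≤ s₀) (ht : 0 ≤ t) (hΛ : ∀ τ, 0 ≤ Λ τ) (hΛi : IntegrableOn Λ (Ici 0))
    (hM : ∫ τ in Ici 0, Λ τ ≤ M) (hF1 : ∀ s, 0 < s → s ≤ t → |F s| ≤ A * B)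
    (hF2 : ∀ s, 0 < s → s₀ < s → s ≤ t → |F s| ≤ Λ (t - s) * A * B) :
    ∫ s in (0 : ℝ)..t, F s ≤ (s₀ + M) * A * B := by
  have hM0 : 0 ≤ M := (setIntegral_nonneg measurableSet_Ici fun τ _ => hΛ τ).trans hM
  have hAB : 0 ≤ A * B := mul_nonneg hA hB
  by_cases hFi : IntervalIntegrable F volume 0 t
  swap
  · rw [intervalIntegral.integral_undef hFi]
    exact mul_nonneg (mul_nonneg (add_nonneg hs₀ hM0) hA) hB
  have hm0 : 0 ≤ min s₀ t := le_min hs₀ ht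
  have hmt : min s₀ t ≤ t := min_le_right _ _
  have hms : min s₀ t ≤ s₀ := min_le_left _ _
  have h01 : IntervalIntegrable F volume 0 (min s₀ t) := hFi.mono_set (by
    rw [uIcc_of_le hm0, uIcc_of_le ht]; exact Icc_subset_Icc le_rfl hmt)
  have h12 : IntervalIntegrable F volume (min s₀ t) t := hFi.mono_set (by
    rw [uIcc_of_le hmt, uIcc_of_le ht]; exact Icc_subset_Icc hm0 le_rfl)
  have hI1 : |∫ s in (0 : ℝ)..min s₀ t, F s| ≤ s₀ * (A * B) := by
    have h1 : ‖∫ s in (0 : ℝ)..min s₀ t, F s‖ ≤ A * B * |min s₀ t - 0| :=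
      intervalIntegral.norm_integral_le_of_norm_le_const fun s hs => by
        rw [uIoc_of_le hm0] at hs
        rw [Real.norm_eq_abs]
        exact hF1 s hs.1 (hs.2.trans hmt)
    rw [Real.norm_eq_abs, sub_zero, abs_of_nonneg hm0] at h1
    calc |∫ s in (0 : ℝ)..min s₀ t, F s| ≤ A * B * min s₀ t := h1
      _ ≤ A * B * s₀ := mul_le_mul_of_nonneg_left hms hAB
      _ = s₀ * (A * B) := by ring
  have hI2 : |∫ s in min s₀ t..t, F s| ≤ M * (A * B) := by
    have hint : IntervalIntegrable (fun s => Λ (t - s) * A * B) volume (min s₀ t) t :=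
      ((intervalIntegrable_comp_sub_left_of_integrableOn hΛi hmt).mul_const A).mul_const B
    have h1 : ‖∫ s in min s₀ t..t, F s‖ ≤ ∫ s in min s₀ t..t, Λ (t - s) * A * B :=
      intervalIntegral.norm_integral_le_of_norm_le hmt (ae_of_all _ fun s hs => by
        rw [Real.norm_eq_abs]
        have hs₀s : s₀ < s := by
          rcases min_lt_iff.1 hs.1 with h' | h'
          · exact h'
          · exact absurd hs.2 (not_le.2 h')
        exact hF2 s (hm0.trans_lt hs.1) hs₀s hs.2) hint
    rw [Real.norm_eq_abs, intervalIntegral.integral_mul_const,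
      intervalIntegral.integral_mul_const] at h1
    calc |∫ s in min s₀ t..t, F s| ≤ (∫ s in min s₀ t..t, Λ (t - s)) * A * B := h1
      _ ≤ M * A * B :=
          mul_le_mul_of_nonneg_right (mul_le_mul_of_nonneg_right
            (integral_comp_sub_left_le hΛ hΛi hM hmt) hA) hB
      _ = M * (A * B) := by ring
  rw [← intervalIntegral.integral_add_adjacent_intervals h01 h12]
  calc (∫ s in (0 : ℝ)..min s₀ t, F s) + ∫ s in min s₀ t..t, F s
      ≤ |∫ s in (0 : ℝ)..min s₀ t, F s| + |∫ s in min s₀ t..t, F s| :=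
        add_le_add (le_abs_self _) (le_abs_self _)
    _ ≤ s₀ * (A * B) + M * (A * B) := add_le_add hI1 hI2
    _ = (s₀ + M) * A * B := by ring

/-! ## Cauchy–Schwarz with absolute value -/

/-- **Cauchy–Schwarz** in `L²(T^d)` with absolute value:
`|∫ f g| ≤ ‖f‖_{L²} ‖g‖_{L²} = (scalarL2Sq f)^{1/2} (scalarL2Sq g)^{1/2}` (apply the one-sided
inequality `integral_mul_le_sqrt_mul_sqrt` to `f` and to `-f`). [folklore] -/
theorem abs_integral_mul_le {d : Type*} [Fintype d] {f g : UnitAddTorus d → ℝ}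
    (hf : MemLp f 2 volume) (hg : MemLp g 2 volume) :
    |∫ x, f x * g x| ≤ √(Torus.scalarL2Sq f) * √(Torus.scalarL2Sq g) := by
  show |∫ x, f x * g x| ≤ √(∫ x, f x ^ 2) * √(∫ x, g x ^ 2)
  rw [abs_le]
  refine ⟨?_, ScalarAnomalySteadySourceFormal.ColdStartVariance.integral_mul_le_sqrt_mul_sqrt hf hg⟩
  have h := ScalarAnomalySteadySourceFormal.ColdStartVariance.integral_mul_le_sqrt_mul_sqrt
    hf.neg hg
  simp only [Pi.neg_apply, neg_mul, integral_neg, neg_sq] at h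
  linarith

/-! ## The stub -/

/-- **D1 `stub_duhamelVariance` (line `Sketch` = duhamel-release, crux `TwoAndHalfD.TwohalfdThesis`).**
Variance bound from the release envelope: with the weak Duhamel identity
`∫ θ(t) χ = ∫₀ᵗ (∫ φ s (t) χ) ds` (tested with `χ := θ(t)`), Cauchy–Schwarz, the `L²` decay of
unforced releases (`antitoneOn_scalarL2Sq`, `κ ≥ 0`) before `s₀` and the envelope
`‖φ s (t)‖ ≤ Λ(t - s)‖h‖` after `s₀`, one gets `‖θ(t)‖² ≤ (s₀ + M)‖h‖‖θ(t)‖`, whence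
`‖θ(t)‖²_{L²} ≤ (s₀ + M)² ‖h‖²_{L²}`. [folklore] -/
theorem stub_duhamelVariance : ∀ (κ s₀ M : ℝ) (u : ℝ → (UnitAddTorus (Fin 2)) → (EuclideanSpace ℝ (Fin 2))) (h : (UnitAddTorus (Fin 2)) → ℝ) (θ : ℝ → (UnitAddTorus (Fin 2)) → ℝ) (φ : ℝ → ℝ → (UnitAddTorus (Fin 2)) → ℝ) (Λ : ℝ → ℝ), 0 ≤ κ → Torus.IsSmooth h → Torus.IsClassicalScalarTransportForcedOn (Ici 0) κ u (fun _ => h) θ → (∀ s, 0 ≤ s → Torus.IsClassicalScalarTransportOn (Ici s) κ u (φ s) ∧ φ s s = h) → (∀ χ : (UnitAddTorus (Fin 2)) → ℝ, Torus.IsSmooth χ → ∀ t, 0 ≤ t → ∫ x, θ t x * χ x = ∫ s in (0 : ℝ)..t, ∫ x, φ s t x * χ x) → 0 ≤ s₀ → (∀ τ, 0 ≤ Λ τ) → IntegrableOn Λ (Ici 0) → (∫ τ in Ici 0, Λ τ) ≤ M → (∀ s t, s₀ ≤ s → s ≤ t → Torus.scalarL2Sq (φ s t) ≤ Λ (t -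 s) ^ 2 * Torus.scalarL2Sq h) → ∀ t, 0 ≤ t → Torus.scalarL2Sq (θ t) ≤ (s₀ + M) ^ 2 * Torus.scalarL2Sq h := by
  intro κ s₀ M u h θ φ Λ hκ _ hθ hφ hD hs₀ hΛ hΛi hM henv t ht
  have hθt : Torus.IsSmooth (θ t) := hθ.smooth_scalar.isSmooth_slice (mem_Ici.2 ht)
  have hA : 0 ≤ √(Torus.scalarL2Sq h) := Real.sqrt_nonneg _
  have hB : 0 ≤ √(Torus.scalarL2Sq (θ t)) := Real.sqrt_nonneg _
  -- the weak Duhamel identity tested with `χ := θ t`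
  have hrep : Torus.scalarL2Sq (θ t) = ∫ s in (0 : ℝ)..t, ∫ x, φ s t x * θ t x := by
    rw [← hD (θ t) hθt t ht]
    exact integral_congr_ae (ae_of_all _ fun x => sq (θ t x))
  -- Cauchy–Schwarz on the Duhamel integrand
  have hFle : ∀ s, 0 ≤ s → s ≤ t →
      |∫ x, φ s t x * θ t x| ≤ √(Torus.scalarL2Sq (φ s t)) * √(Torus.scalarL2Sq (θ t)) :=
    fun s hs hst => abs_integral_mul_le
      (((hφ s hs).1.smooth_scalar.isSmooth_slice (mem_Ici.2 hst)).memLp 2) (hθt.memLp 2)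
  -- the split estimate
  have hbound : ∫ s in (0 : ℝ)..t, (∫ x, φ s t x * θ t x) ≤
      (s₀ + M) * √(Torus.scalarL2Sq h) * √(Torus.scalarL2Sq (θ t)) := by
    refine integral_le_of_release_envelope hA hB hs₀ ht hΛ hΛi hM (fun s hs hst => ?_)
      (fun s hs hs₀s hst => ?_)
    · -- releases before `s₀`: the `L²` norm of an unforced release does not increase
      refine (hFle s hs.le hst).trans (mul_le_mul_of_nonneg_right (Real.sqrt_le_sqrt ?_) hB)
      have hanti : Torus.scalarL2Sq (φ s t) ≤ Torus.scalarL2Sq (φ s s) :=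
        (hφ s hs.le).1.antitoneOn_scalarL2Sq hκ (Icc_subset_Ici_self : Icc s t ⊆ Ici s)
          (left_mem_Icc.2 hst) (right_mem_Icc.2 hst) hst
      rwa [(hφ s hs.le).2] at hanti
    · -- releases after `s₀`: the envelope
      refine (hFle s hs.le hst).trans (mul_le_mul_of_nonneg_right ?_ hB)
      calc √(Torus.scalarL2Sq (φ s t)) ≤ √(Λ (t - s) ^ 2 * Torus.scalarL2Sq h) :=
            Real.sqrt_le_sqrt (henv s t hs₀s.le hst)
        _ = Λ (t - s) * √(Torus.scalarL2Sq h) := by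
            rw [Real.sqrt_mul (sq_nonneg _), Real.sqrt_sq (hΛ _)]
  -- `B² ≤ K B ⇒ B² ≤ K²`
  rw [← hrep, mul_assoc] at hbound
  have key := sq_le_sq_of_sq_le_mul
    (B := √(Torus.scalarL2Sq (θ t))) (K := (s₀ + M) * √(Torus.scalarL2Sq h))
    (by rwa [Real.sq_sqrt (Torus.scalarL2Sq_nonneg _), mul_assoc])
  rwa [Real.sq_sqrt (Torus.scalarL2Sq_nonneg _), mul_pow,
    Real.sq_sqrt (Torus.scalarL2Sq_nonneg _)] at key

end Summit.AnomalousDissipation.AnomalousDissipation.Theorems.TwohalfdThesis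

end
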